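import Summits.HodgeConjecture.HodgeConjecture.Theorems.F0P6aLineSpecialisationLayer
import HarnessLib

/-!
# `F0P6aLineSpecialisationFibres` — ★ RE-HOME of `Lines/F0_P6a_LineSpecialisation.lean` (tree ED. 3 sha16 d6354130763e131e), PART 3 of 6 — tree lines :645–:960.

See PART 1 `Theorems/F0P6aLineSpecialisationLetters.lean` for the full ★ re-home header and the original module docstring (verbatim there).  Same namespace (every fully-qualified name unchanged);
the scopes open at the cut (`noncomputable section` ∕ `namespace` ∕ `section`s) are re-opened below with their `variable` ∕ `open` ∕ `set_option` ∕ `omit` ∕ `include` ∕ `universe` lines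
replayed verbatim from the tree, in order; the code after the replay block is the tree bytes :645–:960, untouched.  HC_CM is proved only modulo the 7 printed citations (2 remaining: hLiu418 = stmt-HodgeConjecture-24832, h413 = stmt-HodgeConjecture-24833) until rung 0 closes; a re-home is count-neutral.
-/

-- ── replay of the scopes open at tree line :645 (verbatim) ──
set_option autoImplicit false
set_option linter.dupNamespace false
noncomputable section
namespace Summit.HodgeConjecture.HodgeConjecture.Cruxes.HLiu418.F0P6aLineSpecialisation
open CategoryTheory CategoryTheory.Limits NumberField IsDedekindDomain MulAction AlgebraicGeometry
open scoped Matrix Polynomial Pointwise MonoidalCategory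
open Literature.NumberTheory.GaloisRepresentations
open Literature.NumberTheory.Automorphic Literature.NumberTheory.Automorphic.UnitaryGroup
open Literature.AlgebraicGeometry.ShimuraVarieties.UnitaryCanonicalModel
open Literature.NumberTheory.Automorphic.Liu2021.AppendixC
open Literature.AlgebraicGeometry.Motives (AlgPoints IntegralModel SchemeOver thickening thickeningGalAction thickeningLift specOver extendPoint
  specValuationSubring specFractionFieldι specRingHomι)
open Literature.NumberTheory.DiophantineGeometry (geomResidueField specialFibreFunctor specResidueField geomClosedPointIsoSpecResidueField
  geomResidueFieldEquiv toClosureValuationSubring)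
open Literature.AlgebraicGeometry.RelativeSpec (ActionOver)
open Literature.NumberTheory.EllipticCurves (genericFibre specGenericPoint)
open Literature.AlgebraicGeometry.AbelianSchemes Literature.AlgebraicGeometry.AbelianSchemes.AbelianSchemeOver
open Literature.AlgebraicGeometry.GroupSchemes.AffineGroupScheme (Alg)
open Summit.HodgeConjecture.HodgeConjecture.Cruxes.HLiu418.F0P6aModuliDatumDefs
open Summit.HodgeConjecture.HodgeConjecture.Cruxes.HLiu418.F0P6aRGDAssembly
open Summit.HodgeConjecture.HodgeConjecture.Cruxes.HLiu418.F0P6aDatumOfInputs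
-- ── tree bytes :645–:960 ──

/-! ### §1a′ the two fibres of the layer and the CHOSEN presentation isos -/

section Fibres

set_option synthInstance.maxHeartbeats 100000

open Literature.AlgebraicGeometry.GroupSchemes (GroupSchemeKernel.ker GroupSchemeKernel.kerι)

variable {F : Type} [Field F] [NumberField F] [IsCMField F] {ι₁ : F →+* ℂ}
    {Jstar : Matrix (Fin 2) (Fin 2) F}
    {K₀ : C5.OpenCompactSubgroup ↥(finAdelic ↥(maximalRealSubfield F) F (IsCMField.complexConj F) 2 Jstar)}
    {S : RecordSystemGS F Jstar ι₁ K₀} {hU7ₛ : S.HeckeTranslateDefinedOver}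
    {hJ : (Jstar.map (IsCMField.complexConj F))ᵀ = Jstar} {hJu : IsUnit Jstar}
    {Fi : Type} [Field Fi] [Algebra F Fi] {Kc : C5.SmallLevel K₀} {G : Type} [Group G]
    {𝓜 : IntegralModel (𝓞 F) F ((thickening F Fi).obj (S.M.obj Kc))}
    {w : HeightOneSpectrum (𝓞 F)} {hw : (IsCMField.complexConj F) • w ≠ w} {h𝓨 : (𝓜.localise w).IsSmoothProper 1}
    {θ : ActionOver (𝓜.localise w).total.hom ((Fi ≃ₐ[F] Fi) × G)}
    {e : Fi →ₐ[F] AlgebraicClosure (w.adicCompletion F)}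

/-- **`sκ w : Spec κ̄(w) ⟶ Spec R`** — the geometric closed point, spelled `Spec.map (ofHom (algebraMap R κ̄))` under `(toGeomκ w).toAlgebra` (the binder shape of ★ `spI`∕S1∕(GF)).
[cite: SerreTate1968, §1 Lemma 2] -/
abbrev sκ (w : HeightOneSpectrum (𝓞 F)) : Spec (.of (geomResidueField w)) ⟶ Spec (.of ↥(closureValuationSubring (w.adicCompletion F))) :=
  letI := (toGeomκ w).toAlgebra
  Spec.map (CommRingCat.ofHom (algebraMap ↥(closureValuationSubring (w.adicCompletion F)) (geomResidueField w)))

/-- **`sΩ w : Spec Ω̄ ⟶ Spec R`** — the generic geometric point `Spec.map (ofHom (algebraMap R Ω̄))`. [cite: SerreTate1968, §1 Lemma 2] -/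
abbrev sΩ (w : HeightOneSpectrum (𝓞 F)) : Spec (.of (AlgebraicClosure (w.adicCompletion F))) ⟶ Spec (.of ↥(closureValuationSubring (w.adicCompletion F))) :=
  Spec.map (CommRingCat.ofHom (algebraMap ↥(closureValuationSubring (w.adicCompletion F)) (AlgebraicClosure (w.adicCompletion F))))

variable (I : RGDInputsAt F ι₁ Jstar K₀ S hU7ₛ hJ hJu Fi Kc G 𝓜 w hw h𝓨 θ e)

/-- **`layerκ I y := layerR I y ×_R κ̄(w)`** — the special fibre of the layer (group structure: Mathlib's transported one, scoped `CategoryTheory.Obj`, under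
`haveI := isMonHom_transR I y`). [cite: Tate1997FiniteFlatGroupSchemes, (3.7)] -/
abbrev layerκ (y : AlgPoints (S.M.obj Kc) (AlgebraicClosure (w.adicCompletion F))) : SchemeOver (geomResidueField w) :=
  (Over.pullback (sκ w)).obj (layerR I y)

/-- **`layerΩ I y := layerR I y ×_R Ω̄`** — the generic geometric fibre of the layer. [cite: Tate1997FiniteFlatGroupSchemes, (3.7)] -/
abbrev layerΩ (y : AlgPoints (S.M.obj Kc) (AlgebraicClosure (w.adicCompletion F))) : SchemeOver (AlgebraicClosure (w.adicCompletion F)) :=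
  (Over.pullback (sΩ w)).obj (layerR I y)

/-- `layerκ I y` is affine (base change of the affine `layerR I y` to a field). [cite: GortzWedhorn2023, Cor. 27.177 (1)] -/
theorem isAffine_layerκ_left (y : AlgPoints (S.M.obj Kc) (AlgebraicClosure (w.adicCompletion F))) : IsAffine (layerκ I y).left := by
  haveI := isFinite_layerR_hom I y
  haveI : IsFinite (layerκ I y).hom := MorphismProperty.pullback_snd _ _ inferInstance
  exact isAffine_of_isAffineHom (layerκ I y).hom

/-- `layerΩ I y` is affine. [cite: GortzWedhorn2023, Cor. 27.177 (1)] -/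
theorem isAffine_layerΩ_left (y : AlgPoints (S.M.obj Kc) (AlgebraicClosure (w.adicCompletion F))) : IsAffine (layerΩ I y).left := by
  haveI := isFinite_layerR_hom I y
  haveI : IsFinite (layerΩ I y).hom := MorphismProperty.pullback_snd _ _ inferInstance
  exact isAffine_of_isAffineHom (layerΩ I y).hom

/-! #### (F1) THE CANONICAL PRESENTATION ISOS (ED. 3; LA3-plan (g2) 2026-09-02T06:56:09Z, LEAD «M-74» (iii), LA2-plan (g2) (R4) 07:12:37Z + CONVERGENCE RULING 08:49:06Z,
LAref-D 07:37:47Z, LA1-p01 (g3) SEAM FINDING 08:48:44Z; pens LA2-p02 (g2) ∕ LA1-p01 (g3)).  ED. 2 had `isoSpecialOf := (exists_iso_special I y).choose`,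
`isoGenericOf := (exists_iso_generic I y).choose` — two independent opaque isos, so `eLOf`∕`εOf`∕`spGeoOf` were pinned only up to an undetermined `𝒪_F`-equivariant
automorphism.  From ED. 3 on both are ★ `AbelianSchemeOver.fibreAlongXIso` (p850434: ★ (d5)∕(DT) made ∃-free — the three pieces `fibreBaseChangeIso ≪≫ fibreCongrPtIso (point
equality) ≪≫ fibreBaseChangeIso⁻¹`, i.e. ★ (ν8R) `AbelianSchemeHomReductionSpecialFibreModel`'s `c_s`∕`c_η`) at `𝒜 := I.univ`, `x̃ := liftOf … y` and the point equalities
`left_red₀Of_comp_specialι_eq` ∕ `left_thickeningLift_comp_genericι_eq` (special base point spelled `Spec (algebraMap R κ̄(w))` under `(toGeomκ w).toAlgebra` = `sκ w`; ★ (ν8R)'s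
`s̄_R = sκ w` is `specMap_toGeomκ_eq`, propositional; `η_R = sΩ w` and `x̃ = liftOf` are `rfl`).  The four served spec lemmas keep their names and statements; new laws: the
pins `iso…Of_eq`, unfolding laws `iso…Of_hom∕_inv`, the three-piece readings `iso…Of_hom∕inv_eq_fibreAlongIso` (`rfl`; ★ `fibreAlongIso` IS the three-piece by definition), `isMonHom_iso…Of_inv`, and the SECTIONS laws `map_iso…Of_hom∕inv_restrictPt`.
KERNEL NOTE (LA2-p02 probes B∕C∕E∕K∕T∕Y∕Z∕D, LA1-p01 probe E7): never `exact` a ★ law across a re-spelled `≫` — rewrite through the unfolding law first; and the two isos stay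
KERNEL-OPAQUE («(F1-SEAL)», LA2-plan (g2) 09:33:22Z: `.choose` of a SINGLETON ∃ `exists_iso…Of_eq`, the pin exported as the theorems `iso…Of_eq`) because a delta-reducible body
makes the kernel run out of memory on the ED. 2 consumers in §1b∕§1d (full-leaflet probe f4c5ced0: `exists_iso_dock_layerR`, `isMonHom_εOf_hom`, `εOf_hom_comp_ι₀G_comp_isoSpecialOf_hom`,
`map_βR_comp_εOf_hom`). -/

set_option backward.isDefEq.respectTransparency false in
/-- **THE PINNED SPECIAL PRESENTATION ISO EXISTS (singleton ∃)**: the ED. 2 type of `isoSpecialOf I y` is inhabited by ★ `fibreAlongXIso` along `left_red₀Of_comp_specialι_eq` (p850434: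
★ (d5)∕(DT) made ∃-free; = ★ (ν8R)'s `c_s`).  A singleton `∃ ψ, ψ = …` so that `isoSpecialOf := (…).choose` keeps ED. 2's kernel-OPAQUE token shape (`Classical.choice` does not
delta-reduce: every ED. 2 consumer in §1b–§1e kernel-checks verbatim) while `choose_spec` exports the pin as the THEOREM `isoSpecialOf_eq` («(F1-SEAL)», LA2-plan (g2) 09:33:22Z).
[cite: SerreTate1968, §1 Lemma 2] [cite: GortzWedhorn2020, Section (4.7) (p. 135), Prop. 4.16] -/
theorem exists_isoSpecialOf_eq (y : AlgPoints (S.M.obj Kc) (AlgebraicClosure (w.adicCompletion F))) :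
    letI := (toGeomκ w).toAlgebra
    ∃ ψ : (sch₀Of 𝓜 w I.univ (red₀Of S Kc 𝓜 w h𝓨 e y)).X ≅ ((famOf I y).baseChange (sκ w)).X,
      ψ = I.univ.fibreAlongXIso (pullback.fst (𝓜.localise w).total.hom (specResidueField w)) (liftOf S Kc 𝓜 w h𝓨 e y).left
      (left_red₀Of_comp_specialι_eq S Kc 𝓜 w h𝓨 e y) :=
  letI := (toGeomκ w).toAlgebra
  ⟨_, rfl⟩

set_option backward.isDefEq.respectTransparency false in
/-- **the special presentation iso** `(σ2)`: `sch₀Of 𝓜 w I.univ (red₀ y) ≅ (famOf I y) ×_R κ̄` — from ED. 3 on PINNED: it IS ★ `fibreAlongXIso` along `left_red₀Of_comp_specialι_eq`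
(`isoSpecialOf_eq`); the body keeps ED. 2's kernel-opaque `.choose` shape, now of a SINGLETON ∃ (ED. 2 chose from ★ (DT)'s bare existence). [cite: SerreTate1968, §1 Lemma 2]
[cite: GortzWedhorn2020, Section (4.7) (p. 135), Prop. 4.16] -/
def isoSpecialOf (y : AlgPoints (S.M.obj Kc) (AlgebraicClosure (w.adicCompletion F))) : (sch₀Of 𝓜 w I.univ (red₀Of S Kc 𝓜 w h𝓨 e y)).X ≅ ((famOf I y).baseChange (sκ w)).X :=
  (exists_isoSpecialOf_eq I y).choose

set_option backward.isDefEq.respectTransparency false in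
/-- THE PIN: `isoSpecialOf I y = I.univ.fibreAlongXIso ι_s ỹ (left_red₀Of_comp_specialι_eq …)` (★ p850434; `choose_spec` of the singleton ∃). [cite: GortzWedhorn2020, Section (4.7) (p. 135), Prop. 4.16] -/
theorem isoSpecialOf_eq (y : AlgPoints (S.M.obj Kc) (AlgebraicClosure (w.adicCompletion F))) :
    letI := (toGeomκ w).toAlgebra
    isoSpecialOf I y = I.univ.fibreAlongXIso (pullback.fst (𝓜.localise w).total.hom (specResidueField w)) (liftOf S Kc 𝓜 w h𝓨 e y).left
      (left_red₀Of_comp_specialι_eq S Kc 𝓜 w h𝓨 e y) :=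
  (exists_isoSpecialOf_eq I y).choose_spec

set_option backward.isDefEq.respectTransparency false in
/-- UNFOLDING LAW: `(isoSpecialOf I y).hom` IS `(I.univ.fibreAlongXIso ι_s ỹ h).hom` (rewrite through it before using a ★ `fibreAlongXIso` law under `≫`).
[cite: GortzWedhorn2020, Section (4.15) (p. 116)] -/
theorem isoSpecialOf_hom (y : AlgPoints (S.M.obj Kc) (AlgebraicClosure (w.adicCompletion F))) :
    letI := (toGeomκ w).toAlgebra
    (isoSpecialOf I y).hom = (I.univ.fibreAlongXIso (pullback.fst (𝓜.localise w).total.hom (specResidueField w)) (liftOf S Kc 𝓜 w h𝓨 e y).left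
      (left_red₀Of_comp_specialι_eq S Kc 𝓜 w h𝓨 e y)).hom := by
  rw [isoSpecialOf_eq]

set_option backward.isDefEq.respectTransparency false in
/-- UNFOLDING LAW for the inverse. [cite: GortzWedhorn2020, Section (4.15) (p. 116)] -/
theorem isoSpecialOf_inv (y : AlgPoints (S.M.obj Kc) (AlgebraicClosure (w.adicCompletion F))) :
    letI := (toGeomκ w).toAlgebra
    (isoSpecialOf I y).inv = (I.univ.fibreAlongXIso (pullback.fst (𝓜.localise w).total.hom (specResidueField w)) (liftOf S Kc 𝓜 w h𝓨 e y).left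
      (left_red₀Of_comp_specialι_eq S Kc 𝓜 w h𝓨 e y)).inv := by
  rw [isoSpecialOf_eq]

set_option backward.isDefEq.respectTransparency false in
/-- THREE-PIECE READING: `(isoSpecialOf I y).hom` is the scheme morphism of ★ `fibreAlongIso` = ★ (d5)'s `fibreBaseChangeIso ≪≫ fibreCongrPtIso ≪≫ fibreBaseChangeIso⁻¹` BY
DEFINITION (`unfold AbelianSchemeOver.fibreAlongIso`; = ★ (ν8R)'s `c_s` with its special base point spelled `Spec (algebraMap R κ̄(w))`).
[cite: GortzWedhorn2020, Section (4.7) (p. 135), Prop. 4.16] [cite: MumfordFogartyKirwan1994, Ch. 7 §2 Definition 7.2 (p. 129)] -/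
theorem isoSpecialOf_hom_eq_fibreAlongIso (y : AlgPoints (S.M.obj Kc) (AlgebraicClosure (w.adicCompletion F))) :
    letI := (toGeomκ w).toAlgebra
    (isoSpecialOf I y).hom = (I.univ.fibreAlongIso (pullback.fst (𝓜.localise w).total.hom (specResidueField w)) (liftOf S Kc 𝓜 w h𝓨 e y).left
      (left_red₀Of_comp_specialι_eq S Kc 𝓜 w h𝓨 e y)).hom.hom.hom.hom := by
  rw [isoSpecialOf_hom]
  exact I.univ.fibreAlongXIso_hom _ _ (left_red₀Of_comp_specialι_eq S Kc 𝓜 w h𝓨 e y)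

set_option backward.isDefEq.respectTransparency false in
/-- THREE-PIECE READING for the inverse (the shape of ★ (ν8R) rows (v-a)∕(v-b)). [cite: GortzWedhorn2020, Section (4.7) (p. 135), Prop. 4.16] -/
theorem isoSpecialOf_inv_eq_fibreAlongIso (y : AlgPoints (S.M.obj Kc) (AlgebraicClosure (w.adicCompletion F))) :
    letI := (toGeomκ w).toAlgebra
    (isoSpecialOf I y).inv = (I.univ.fibreAlongIso (pullback.fst (𝓜.localise w).total.hom (specResidueField w)) (liftOf S Kc 𝓜 w h𝓨 e y).left
      (left_red₀Of_comp_specialι_eq S Kc 𝓜 w h𝓨 e y)).inv.hom.hom.hom := by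
  rw [isoSpecialOf_inv]
  exact I.univ.fibreAlongXIso_inv _ _ (left_red₀Of_comp_specialι_eq S Kc 𝓜 w h𝓨 e y)

/-- its `hom` is a homomorphism. [cite: MumfordFogartyKirwan1994, Ch. 7 §2 Definition 7.2 (p. 129)] -/
theorem isMonHom_isoSpecialOf_hom (y : AlgPoints (S.M.obj Kc) (AlgebraicClosure (w.adicCompletion F))) : IsMonHom (isoSpecialOf I y).hom :=
  by
  letI := (toGeomκ w).toAlgebra
  rw [isoSpecialOf_hom]
  exact I.univ.isMonHom_fibreAlongXIso_hom (pullback.fst (𝓜.localise w).total.hom (specResidueField w)) (liftOf S Kc 𝓜 w h𝓨 e y).left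
    (left_red₀Of_comp_specialι_eq S Kc 𝓜 w h𝓨 e y)

/-- its `inv` is a homomorphism. [cite: MumfordFogartyKirwan1994, Ch. 7 §2 Definition 7.2 (p. 129)] -/
theorem isMonHom_isoSpecialOf_inv (y : AlgPoints (S.M.obj Kc) (AlgebraicClosure (w.adicCompletion F))) : IsMonHom (isoSpecialOf I y).inv := by
  letI := (toGeomκ w).toAlgebra
  rw [isoSpecialOf_inv]
  exact I.univ.isMonHom_fibreAlongXIso_inv (pullback.fst (𝓜.localise w).total.hom (specResidueField w)) (liftOf S Kc 𝓜 w h𝓨 e y).left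
    (left_red₀Of_comp_specialι_eq S Kc 𝓜 w h𝓨 e y)

set_option backward.isDefEq.respectTransparency false in
/-- it intertwines the two base-changed `𝒪_F`-actions. [cite: Kottwitz1992, §5, p. 390] -/
theorem act₀_i_comp_isoSpecialOf_hom (y : AlgPoints (S.M.obj Kc) (AlgebraicClosure (w.adicCompletion F))) (a : 𝓞 F) :
    ((I.act.baseChange (pullback.fst (𝓜.localise w).total.hom (specResidueField w))).baseChange (red₀Of S Kc 𝓜 w h𝓨 e y).left).i a ≫
        (isoSpecialOf I y).hom =
      (isoSpecialOf I y).hom ≫ ((actFamOf I y).baseChange (sκ w)).i a :=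
  by
  -- (F1): ★ equivariance law, read through the `rfl` unfolding law (a direct `exact` under `≫` exhausts the kernel; LA1-p01 probe E7, LA2-p02 probes)
  letI := (toGeomκ w).toAlgebra
  rw [isoSpecialOf_hom]
  exact I.univ.baseChange_i_comp_fibreAlongXIso_hom (pullback.fst (𝓜.localise w).total.hom (specResidueField w)) (liftOf S Kc 𝓜 w h𝓨 e y).left
    (left_red₀Of_comp_specialι_eq S Kc 𝓜 w h𝓨 e y) I.act a

set_option backward.isDefEq.respectTransparency false in
/-- SECTIONS LAW: `isoSpecialOf` carries the value at `red₀ y` of a pulled-back section `τ ×_𝓨 𝓨_s` to the value at `sκ w` of `τ ×_𝓨 ỹ` (★ `map_fibreAlongXIso_hom_restrictPt`; the law the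
LVL rows consume). [cite: MumfordFogartyKirwan1994, Ch. 7 §2 Definition 7.2 (p. 129)] -/
theorem map_isoSpecialOf_hom_restrictPt (y : AlgPoints (S.M.obj Kc) (AlgebraicClosure (w.adicCompletion F))) (τ : I.univ.Sections) :
    letI := (toGeomκ w).toAlgebra
    AlgPoints.map (isoSpecialOf I y).hom
        ((I.univ.baseChange (pullback.fst (𝓜.localise w).total.hom (specResidueField w))).restrictPt (red₀Of S Kc 𝓜 w h𝓨 e y).left
          (I.univ.sectionBaseChange (pullback.fst (𝓜.localise w).total.hom (specResidueField w)) τ)) =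
      (famOf I y).restrictPt (sκ w) (I.univ.sectionBaseChange (liftOf S Kc 𝓜 w h𝓨 e y).left τ) :=
  letI := (toGeomκ w).toAlgebra
  (congrArg (fun m => AlgPoints.map m ((I.univ.baseChange (pullback.fst (𝓜.localise w).total.hom (specResidueField w))).restrictPt
      (red₀Of S Kc 𝓜 w h𝓨 e y).left (I.univ.sectionBaseChange (pullback.fst (𝓜.localise w).total.hom (specResidueField w)) τ))) (isoSpecialOf_hom I y)).trans
    (I.univ.map_fibreAlongXIso_hom_restrictPt (pullback.fst (𝓜.localise w).total.hom (specResidueField w)) (liftOf S Kc 𝓜 w h𝓨 e y).left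
      (left_red₀Of_comp_specialι_eq S Kc 𝓜 w h𝓨 e y) τ)

set_option backward.isDefEq.respectTransparency false in
/-- SECTIONS LAW for the inverse (★ `map_fibreAlongXIso_inv_restrictPt`). [cite: MumfordFogartyKirwan1994, Ch. 7 §2 Definition 7.2 (p. 129)] -/
theorem map_isoSpecialOf_inv_restrictPt (y : AlgPoints (S.M.obj Kc) (AlgebraicClosure (w.adicCompletion F))) (τ : I.univ.Sections) :
    letI := (toGeomκ w).toAlgebra
    AlgPoints.map (isoSpecialOf I y).inv ((famOf I y).restrictPt (sκ w) (I.univ.sectionBaseChange (liftOf S Kc 𝓜 w h𝓨 e y).left τ)) =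
      (I.univ.baseChange (pullback.fst (𝓜.localise w).total.hom (specResidueField w))).restrictPt (red₀Of S Kc 𝓜 w h𝓨 e y).left
        (I.univ.sectionBaseChange (pullback.fst (𝓜.localise w).total.hom (specResidueField w)) τ) :=
  letI := (toGeomκ w).toAlgebra
  (congrArg (fun m => AlgPoints.map m ((famOf I y).restrictPt (sκ w) (I.univ.sectionBaseChange (liftOf S Kc 𝓜 w h𝓨 e y).left τ)))
      (isoSpecialOf_inv I y)).trans
    (I.univ.map_fibreAlongXIso_inv_restrictPt (pullback.fst (𝓜.localise w).total.hom (specResidueField w)) (liftOf S Kc 𝓜 w h𝓨 e y).left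
      (left_red₀Of_comp_specialι_eq S Kc 𝓜 w h𝓨 e y) τ)

set_option backward.isDefEq.respectTransparency false in
/-- **THE PINNED GENERIC PRESENTATION ISO EXISTS (singleton ∃)**: the ED. 2 type of `isoGenericOf I y` is inhabited by ★ `fibreAlongXIso` along `left_thickeningLift_comp_genericι_eq`
(= ★ (ν8R)'s `c_η`; `η_R = sΩ w`, `x̃ = liftOf … y` definitionally). [cite: SerreTate1968, §1 Lemma 2] [cite: GortzWedhorn2020, Section (4.7) (p. 135), Prop. 4.16] -/
theorem exists_isoGenericOf_eq (y : AlgPoints (S.M.obj Kc) (AlgebraicClosure (w.adicCompletion F))) :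
    ∃ φ : (schΩOf S Kc 𝓜 w e I.univ y).X ≅ ((famOf I y).baseChange (sΩ w)).X,
      φ = I.univ.fibreAlongXIso ((𝓜.localise w).genericIso'.inv.left ≫
      pullback.fst (𝓜.localise w).total.hom (specGenericPoint (HeightOneSpectrum.valuationSubringAtPrime F w) F)) (liftOf S Kc 𝓜 w h𝓨 e y).left
      (left_thickeningLift_comp_genericι_eq S Kc 𝓜 w h𝓨 e y) :=
  ⟨_, rfl⟩

set_option backward.isDefEq.respectTransparency false in
/-- **the generic presentation iso** `(σ3)`: `schΩOf … I.univ y ≅ (famOf I y) ×_R Ω̄` — from ED. 3 on PINNED (`isoGenericOf_eq`; kernel-opaque `.choose` of a singleton ∃).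
[cite: SerreTate1968, §1 Lemma 2] [cite: GortzWedhorn2020, Section (4.7) (p. 135), Prop. 4.16] -/
def isoGenericOf (y : AlgPoints (S.M.obj Kc) (AlgebraicClosure (w.adicCompletion F))) : (schΩOf S Kc 𝓜 w e I.univ y).X ≅ ((famOf I y).baseChange (sΩ w)).X :=
  (exists_isoGenericOf_eq I y).choose

set_option backward.isDefEq.respectTransparency false in
/-- THE PIN: `isoGenericOf I y = I.univ.fibreAlongXIso ι_η ỹ (left_thickeningLift_comp_genericι_eq …)` (★ p850434). [cite: GortzWedhorn2020, Section (4.7) (p. 135), Prop. 4.16] -/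
theorem isoGenericOf_eq (y : AlgPoints (S.M.obj Kc) (AlgebraicClosure (w.adicCompletion F))) :
    isoGenericOf I y = I.univ.fibreAlongXIso ((𝓜.localise w).genericIso'.inv.left ≫
      pullback.fst (𝓜.localise w).total.hom (specGenericPoint (HeightOneSpectrum.valuationSubringAtPrime F w) F)) (liftOf S Kc 𝓜 w h𝓨 e y).left
      (left_thickeningLift_comp_genericι_eq S Kc 𝓜 w h𝓨 e y) :=
  (exists_isoGenericOf_eq I y).choose_spec

set_option backward.isDefEq.respectTransparency false in
/-- UNFOLDING LAW: `(isoGenericOf I y).hom` IS `(I.univ.fibreAlongXIso ι_η ỹ h).hom`. [cite: GortzWedhorn2020, Section (4.15) (p. 116)] -/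
theorem isoGenericOf_hom (y : AlgPoints (S.M.obj Kc) (AlgebraicClosure (w.adicCompletion F))) :
    (isoGenericOf I y).hom = (I.univ.fibreAlongXIso ((𝓜.localise w).genericIso'.inv.left ≫
      pullback.fst (𝓜.localise w).total.hom (specGenericPoint (HeightOneSpectrum.valuationSubringAtPrime F w) F)) (liftOf S Kc 𝓜 w h𝓨 e y).left
      (left_thickeningLift_comp_genericι_eq S Kc 𝓜 w h𝓨 e y)).hom := by
  rw [isoGenericOf_eq]

set_option backward.isDefEq.respectTransparency false in
/-- UNFOLDING LAW for the inverse. [cite: GortzWedhorn2020, Section (4.15) (p. 116)] -/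
theorem isoGenericOf_inv (y : AlgPoints (S.M.obj Kc) (AlgebraicClosure (w.adicCompletion F))) :
    (isoGenericOf I y).inv = (I.univ.fibreAlongXIso ((𝓜.localise w).genericIso'.inv.left ≫
      pullback.fst (𝓜.localise w).total.hom (specGenericPoint (HeightOneSpectrum.valuationSubringAtPrime F w) F)) (liftOf S Kc 𝓜 w h𝓨 e y).left
      (left_thickeningLift_comp_genericι_eq S Kc 𝓜 w h𝓨 e y)).inv := by
  rw [isoGenericOf_eq]

set_option backward.isDefEq.respectTransparency false in
/-- THREE-PIECE READING: `(isoGenericOf I y).hom` is the scheme morphism of ★ `fibreAlongIso` = ★ (d5)'s three-piece composite BY DEFINITION (= ★ (ν8R)'s `c_η`;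
`η_R = Spec (algebraMap R Ω̄) = sΩ w` and `x̃ = liftOf … y` definitionally). [cite: GortzWedhorn2020, Section (4.7) (p. 135), Prop. 4.16] -/
theorem isoGenericOf_hom_eq_fibreAlongIso (y : AlgPoints (S.M.obj Kc) (AlgebraicClosure (w.adicCompletion F))) :
    (isoGenericOf I y).hom = (I.univ.fibreAlongIso ((𝓜.localise w).genericIso'.inv.left ≫
      pullback.fst (𝓜.localise w).total.hom (specGenericPoint (HeightOneSpectrum.valuationSubringAtPrime F w) F)) (liftOf S Kc 𝓜 w h𝓨 e y).left
      (left_thickeningLift_comp_genericι_eq S Kc 𝓜 w h𝓨 e y)).hom.hom.hom.hom := by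
  rw [isoGenericOf_hom]
  exact I.univ.fibreAlongXIso_hom _ _ (left_thickeningLift_comp_genericι_eq S Kc 𝓜 w h𝓨 e y)

set_option backward.isDefEq.respectTransparency false in
/-- THREE-PIECE READING for the inverse (the shape of ★ (ν8R) rows (v-a)∕(v-b)). [cite: GortzWedhorn2020, Section (4.7) (p. 135), Prop. 4.16] -/
theorem isoGenericOf_inv_eq_fibreAlongIso (y : AlgPoints (S.M.obj Kc) (AlgebraicClosure (w.adicCompletion F))) :
    (isoGenericOf I y).inv = (I.univ.fibreAlongIso ((𝓜.localise w).genericIso'.inv.left ≫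
      pullback.fst (𝓜.localise w).total.hom (specGenericPoint (HeightOneSpectrum.valuationSubringAtPrime F w) F)) (liftOf S Kc 𝓜 w h𝓨 e y).left
      (left_thickeningLift_comp_genericι_eq S Kc 𝓜 w h𝓨 e y)).inv.hom.hom.hom := by
  rw [isoGenericOf_inv]
  exact I.univ.fibreAlongXIso_inv _ _ (left_thickeningLift_comp_genericι_eq S Kc 𝓜 w h𝓨 e y)

/-- its `hom` is a homomorphism. [cite: MumfordFogartyKirwan1994, Ch. 7 §2 Definition 7.2 (p. 129)] -/
theorem isMonHom_isoGenericOf_hom (y : AlgPoints (S.M.obj Kc) (AlgebraicClosure (w.adicCompletion F))) : IsMonHom (isoGenericOf I y).hom :=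
  by
  rw [isoGenericOf_hom]
  exact I.univ.isMonHom_fibreAlongXIso_hom ((𝓜.localise w).genericIso'.inv.left ≫
      pullback.fst (𝓜.localise w).total.hom (specGenericPoint (HeightOneSpectrum.valuationSubringAtPrime F w) F)) (liftOf S Kc 𝓜 w h𝓨 e y).left
    (left_thickeningLift_comp_genericι_eq S Kc 𝓜 w h𝓨 e y)

/-- its `inv` is a homomorphism. [cite: MumfordFogartyKirwan1994, Ch. 7 §2 Definition 7.2 (p. 129)] -/
theorem isMonHom_isoGenericOf_inv (y : AlgPoints (S.M.obj Kc) (AlgebraicClosure (w.adicCompletion F))) : IsMonHom (isoGenericOf I y).inv := by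
  rw [isoGenericOf_inv]
  exact I.univ.isMonHom_fibreAlongXIso_inv ((𝓜.localise w).genericIso'.inv.left ≫
      pullback.fst (𝓜.localise w).total.hom (specGenericPoint (HeightOneSpectrum.valuationSubringAtPrime F w) F)) (liftOf S Kc 𝓜 w h𝓨 e y).left
    (left_thickeningLift_comp_genericι_eq S Kc 𝓜 w h𝓨 e y)

set_option backward.isDefEq.respectTransparency false in
/-- `rfl` re-spelling: `actΩOf … a y` on schemes IS the doubly base-changed action `((I.act ×_𝓨 Y) ×_Y ℓ_e y).i a` (★ `fibreHom_hom_hom_hom`, ★ `RingAction.baseChange_i`).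
[cite: Kottwitz1992, §5, p. 390] -/
theorem actΩOf_hom_hom_hom_eq_baseChange_i (y : AlgPoints (S.M.obj Kc) (AlgebraicClosure (w.adicCompletion F))) (a : 𝓞 F) :
    (actΩOf S Kc 𝓜 w e I.univ I.act a y).hom.hom.hom =
      ((I.act.baseChange ((𝓜.localise w).genericIso'.inv.left ≫
          pullback.fst (𝓜.localise w).total.hom (specGenericPoint (HeightOneSpectrum.valuationSubringAtPrime F w) F))).baseChange
        (thickeningLift e (S.M.obj Kc) y).left).i a := rfl

set_option backward.isDefEq.respectTransparency false in
/-- it intertwines `actΩOf … a y` with `((actFamOf I y) ×_R Ω̄).i a`. [cite: Kottwitz1992, §5, p. 390] -/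
theorem actΩ_comp_isoGenericOf_hom (y : AlgPoints (S.M.obj Kc) (AlgebraicClosure (w.adicCompletion F))) (a : 𝓞 F) :
    (actΩOf S Kc 𝓜 w e I.univ I.act a y).hom.hom.hom ≫ (isoGenericOf I y).hom = (isoGenericOf I y).hom ≫ ((actFamOf I y).baseChange (sΩ w)).i a :=
  by
  -- (F1): ★ equivariance law, read through the two `rfl` laws
  rw [actΩOf_hom_hom_hom_eq_baseChange_i, isoGenericOf_hom]
  exact I.univ.baseChange_i_comp_fibreAlongXIso_hom ((𝓜.localise w).genericIso'.inv.left ≫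
      pullback.fst (𝓜.localise w).total.hom (specGenericPoint (HeightOneSpectrum.valuationSubringAtPrime F w) F)) (liftOf S Kc 𝓜 w h𝓨 e y).left
    (left_thickeningLift_comp_genericι_eq S Kc 𝓜 w h𝓨 e y) I.act a

set_option backward.isDefEq.respectTransparency false in
/-- SECTIONS LAW: `isoGenericOf` carries the value at `ℓ_e y` of `τ ×_𝓨 Y` to the value at `sΩ w` of `τ ×_𝓨 ỹ` (★ `map_fibreAlongXIso_hom_restrictPt`; the LVL rows' law).
[cite: MumfordFogartyKirwan1994, Ch. 7 §2 Definition 7.2 (p. 129)] -/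
theorem map_isoGenericOf_hom_restrictPt (y : AlgPoints (S.M.obj Kc) (AlgebraicClosure (w.adicCompletion F))) (τ : I.univ.Sections) :
    AlgPoints.map (isoGenericOf I y).hom
        ((I.univ.baseChange ((𝓜.localise w).genericIso'.inv.left ≫
            pullback.fst (𝓜.localise w).total.hom (specGenericPoint (HeightOneSpectrum.valuationSubringAtPrime F w) F))).restrictPt
          (thickeningLift e (S.M.obj Kc) y).left
          (I.univ.sectionBaseChange ((𝓜.localise w).genericIso'.inv.left ≫
            pullback.fst (𝓜.localise w).total.hom (specGenericPoint (HeightOneSpectrum.valuationSubringAtPrime F w) F)) τ)) =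
      (famOf I y).restrictPt (sΩ w) (I.univ.sectionBaseChange (liftOf S Kc 𝓜 w h𝓨 e y).left τ) :=
  (congrArg (fun m => AlgPoints.map m ((I.univ.baseChange ((𝓜.localise w).genericIso'.inv.left ≫
            pullback.fst (𝓜.localise w).total.hom (specGenericPoint (HeightOneSpectrum.valuationSubringAtPrime F w) F))).restrictPt
      (thickeningLift e (S.M.obj Kc) y).left (I.univ.sectionBaseChange ((𝓜.localise w).genericIso'.inv.left ≫
            pullback.fst (𝓜.localise w).total.hom (specGenericPoint (HeightOneSpectrum.valuationSubringAtPrime F w) F)) τ))) (isoGenericOf_hom I y)).trans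
    (I.univ.map_fibreAlongXIso_hom_restrictPt ((𝓜.localise w).genericIso'.inv.left ≫
        pullback.fst (𝓜.localise w).total.hom (specGenericPoint (HeightOneSpectrum.valuationSubringAtPrime F w) F)) (liftOf S Kc 𝓜 w h𝓨 e y).left
      (left_thickeningLift_comp_genericι_eq S Kc 𝓜 w h𝓨 e y) τ)

set_option backward.isDefEq.respectTransparency false in
/-- SECTIONS LAW for the inverse (★ `map_fibreAlongXIso_inv_restrictPt`). [cite: MumfordFogartyKirwan1994, Ch. 7 §2 Definition 7.2 (p. 129)] -/
theorem map_isoGenericOf_inv_restrictPt (y : AlgPoints (S.M.obj Kc) (AlgebraicClosure (w.adicCompletion F))) (τ : I.univ.Sections) :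
    AlgPoints.map (isoGenericOf I y).inv ((famOf I y).restrictPt (sΩ w) (I.univ.sectionBaseChange (liftOf S Kc 𝓜 w h𝓨 e y).left τ)) =
      (I.univ.baseChange ((𝓜.localise w).genericIso'.inv.left ≫
          pullback.fst (𝓜.localise w).total.hom (specGenericPoint (HeightOneSpectrum.valuationSubringAtPrime F w) F))).restrictPt
        (thickeningLift e (S.M.obj Kc) y).left
        (I.univ.sectionBaseChange ((𝓜.localise w).genericIso'.inv.left ≫
          pullback.fst (𝓜.localise w).total.hom (specGenericPoint (HeightOneSpectrum.valuationSubringAtPrime F w) F)) τ) :=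
  (congrArg (fun m => AlgPoints.map m ((famOf I y).restrictPt (sΩ w) (I.univ.sectionBaseChange (liftOf S Kc 𝓜 w h𝓨 e y).left τ)))
      (isoGenericOf_inv I y)).trans
    (I.univ.map_fibreAlongXIso_inv_restrictPt ((𝓜.localise w).genericIso'.inv.left ≫
        pullback.fst (𝓜.localise w).total.hom (specGenericPoint (HeightOneSpectrum.valuationSubringAtPrime F w) F)) (liftOf S Kc 𝓜 w h𝓨 e y).left
      (left_thickeningLift_comp_genericι_eq S Kc 𝓜 w h𝓨 e y) τ)

end Fibres


/-! (★ re-home, size lint: PART 3 of 6 ends here at tree line :960; continued in `Theorems/F0P6aLineSpecialisationGeneric.lean`.) -/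

end Summit.HodgeConjecture.HodgeConjecture.Cruxes.HLiu418.F0P6aLineSpecialisation
end
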